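import Summits.QuantumFields.YangMills.Theorems.BalabanUVNodesN19SizeWindowNodes

/-!
# BalabanUVNodes ∕ N19 ledger link — «Link S R» TYPED: the two-run LEDGER predicate that ties the spine carriers of node N19 to the
# rate carriers of its in-edges, and the N19 edge `∃ δ, Spine.NE7.Core … δ ∧ Summable δ` FROM IT by the landed knit (seat dag-n19-b;
# STAGED companion of [DAGN19B-G0-K5-SIGNATURE-1∕2]; count-neutral; Track A node N19, cluster K5 «SpineMatching»)

HONEST FRAMING.  NE7 is NOT PRINTED and NOT proved.  This file defines ONE data bundle `LedgerData` and ONE `Prop`-valued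
predicate `LedgerAt` = EXACTLY the binders of the N19 knits (`N19CoreKnit.core_summable_of_spineNodes`, dag-n19-a p409134;
`N19SizeWindow.core_summable_of_nodes_polySize`, p409886) that are NEITHER an in-edge statement of record (N16∕N17∕N18∕N22 —
`RatesAt` of the K4 supply) NOR the printed-grade argument bracket (T) NOR node U2's β-side: the synchronised two-run TERM FORMAT of the
good-class cores as pending positive integrals of the (2.25)-ledger (node U5a), the one-run SIZE centring in the (2.43) log-window
profile, MULTIPLICITY ((0.26)), the other kinds, and hazard H-U5b-1 asked uniformly in the tower constant — i.e. the CONTENT a spine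
record predicate `SRec` must carry about `(S, R)` for the drafted K5 stub `S_N19` to be provable by the knit (design points (P1)–(P3) of
the seat's bus lines).  Every field is a HYPOTHESIS SHAPE about Bałaban's two-run (2.18) ledger (cell NODE O; no tree object); nothing
is asserted.  `core_summable_of_ledgerAt` is the N19 edge in node U2's OUTPUT letter (`InjectedRate … disc`): `LedgerAt` + NE3 (minimal
currency `LocalRate` + liaison `GaugeDominated`) + NE5 + NE9 ∧ fading memory + (T) + U2's output ⇒ `∃ δ, Spine.NE7.Core … δ ∧ Summable δ`
— ONE line over p409886.  One fixed finite torus, rung (B)+1; NOT infinite volume, NOT a mass gap, NOT Clay.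

CITATION HEADER.  [Balaban1988Convergent] (2.25) p. 259 (vacuum-energy subtraction — the shape of the ledger's E-factors), Thm 2 (2.43)
p. 263 (one-run size with large-field volumes — the profile); [Balaban1987RG1] (0.26) p. 257 (domain counting — multiplicity).  Quoted
in the tree's `T4TermwiseBudget` ∕ `B14.Thm2Printed` docstrings; used ONLY as shapes of hypotheses.
-/

open Finset MeasureTheory

namespace Summit.QuantumFields.YangMills.BalabanUVNodes.N19SizeWindow

open Literature.MathematicalPhysics.QuantumFieldTheory.Balaban1983to89
open T4OutputRate T4RecentScale T4GoodClassBudget T4CauchySum T4TowerRateComposition T4TowerRateDischarge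
  T4TermwiseBudget
open T4EtaRateMin (Readings LocalRate)
open T4RateLiaison (GaugeDominated)
open Summit.QuantumFields.BalabanUV.T4Continuum.Spine

/-! ## §1 The ledger DATA a spine record must supply beyond the spine carriers and the rate carriers -/

/-- **LEDGER DATA** of one loop string along one tuned run (what «Link S R» quantifies existentially): the common fluctuation
measures `μ K t τ` on the field space `ι` of NE3's reading family, the (2.25)-shaped E-ledger `fac K t τ` (domains of node U3's
carriers `C`), the reference backgrounds `oneA`, `oneB` of the vacuum-energy subtraction, the aggregated OTHER kinds `oA`, `oB` with
their centres `cO` and radii `RO ≤ vol·rO K`, the one-run SIZE centring `κ₁`, `S`, the multiplicity constant `Cw` and base `Λg`, the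
size letters `E₀`, `m`, `a` of the (2.43) log-window profile, and ONE common rate `θ′` (the proof's choice, recorded as data).
Nothing of Bałaban's is constructed. [folklore] (a definition of a data bundle; no estimate) -/
structure LedgerData (C : Carriers) (ι : Type) [MeasurableSpace ι] (σ : Type*) where
  /-- common fluctuation measure of the good term `τ` at cutoff `K`, source `t` -/
  μ : ℕ → ℝ → σ → Measure ι
  /-- the (2.25)-ledger of matched E-factor domains of the term -/
  fac : ℕ → ℝ → σ → Finset C.Dom
  /-- reference backgrounds of the vacuum-energy subtraction, run A ∕ run B -/
  oneA : C.BgA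
  oneB : C.BgB
  /-- aggregated other kinds (R-, boundary-, observable-attached factors), run A ∕ run B -/
  oA : ℕ → ℝ → σ → ι → ℝ
  oB : ℕ → ℝ → σ → ι → ℝ
  /-- one-run size centres and radii per creation-scale slice -/
  κ₁ : ℕ → ℝ → σ → ℕ → ℝ
  S : ℕ → ℝ → σ → ℕ → ℝ
  /-- other kinds: centre, radius, per-unit-volume radius profile -/
  cO : ℕ → ℝ → σ → ℝ
  RO : ℕ → ℝ → σ → ℝ
  rO : ℕ → ℝ
  /-- multiplicity constant and base; size letters of the (2.43) window profile; the common rate -/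
  Cw : ℝ
  Λg : ℝ
  E₀ : ℝ
  m : ℕ
  a : ℝ
  θ' : ℝ

/-! ## §2 «Link S R» — the LEDGER PREDICATE -/

/-- **`LedgerAt`** — the two-run LEDGER PREDICATE linking the spine carriers (`l₀ vol T Bad` and the good-class CORES `A`, `B`, i.e.
`S.A − S.shA`, `S.B − S.shB` of the supply's `SpineCarriers`) to the rate carriers of the in-edges (node U3's `C`, `EA`, `EB`, `κ`, the
re-indexed coupling tables `g`, NE3's reading family `R` with the background maps `uA`, `uB`, and the rate letters `ω θc θ₅ θ₃` that the
common rate must dominate): the binders of `T4TermwiseBudget.termBudget_of_nodes` ∕ the N19 knits that are NOT in-edge statements —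
TERM FORMAT (`fmtA fmtB int sc posO off`), one-run SIZE centring in the (2.43) log-window profile (`size sizeProfile`), MULTIPLICITY
(`mult`), OTHER KINDS (`other RO_le rO_summable`), the letter signs and the rate ordering, and hazard H-U5b-1 UNIFORMLY in the tower
constant (`dev`: for every `Cr ≥ 0` some t-free class constants `c₀` with a SUMMABLE deviation profile `s`).  A HYPOTHESIS SHAPE (cell
NODE O: Bałaban's two-run (2.18) ledger; NOT PRINTED as a two-run statement); nothing asserted. [folklore] -/
structure LedgerAt {C : Carriers} {ι X : Type} [MeasurableSpace ι] {σ : Type*} [DecidableEq σ] (L : LedgerData C ι σ)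
    (l₀ vol : ℝ) (T : ℕ → Finset σ) (Bad : ℕ → ℝ → Finset σ) (A B : ℕ → ℝ → σ → ℝ)
    (R : Readings ι X) (EA : Functional C C.BgA) (EB : Functional C C.BgB) (κ : ℝ) (g : ℕ → ℕ → ℝ)
    (uA : ℕ → ι → C.BgA) (uB : ℕ → ι → C.BgB) (ω θc θ₅ θ₃ : ℝ) : Prop where
  fmtA : ∀ K t τ, A K t τ = ∫ v, (∏ Y ∈ L.fac K t τ,
    Real.exp (EA (g K) (uA K v) Y - EA (g K) L.oneA Y)) * L.oA K t τ v ∂(L.μ K t τ)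
  fmtB : ∀ K t τ, B K t τ = ∫ v, (∏ Y ∈ L.fac K t τ,
    Real.exp (EB (fun i => g (K + 1) (i + 1)) (uB K v) Y - EB (fun i => g (K + 1) (i + 1)) L.oneB Y)) *
      L.oB K t τ v ∂(L.μ K t τ)
  int : ∀ K t, |t| ≤ l₀ → ∀ τ ∈ T K \ Bad K t,
    Integrable (fun v => (∏ Y ∈ L.fac K t τ, Real.exp (EA (g K) (uA K v) Y - EA (g K) L.oneA Y)) *
      L.oA K t τ v) (L.μ K t τ) ∧
    Integrable (fun v => (∏ Y ∈ L.fac K t τ,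
      Real.exp (EB (fun i => g (K + 1) (i + 1)) (uB K v) Y - EB (fun i => g (K + 1) (i + 1)) L.oneB Y)) *
      L.oB K t τ v) (L.μ K t τ)
  sc : ∀ K t, |t| ≤ l₀ → ∀ τ ∈ T K \ Bad K t, ∀ Y ∈ L.fac K t τ, C.scale Y ≤ K
  posO : ∀ K t, |t| ≤ l₀ → ∀ τ ∈ T K \ Bad K t, ∀ v ∈ R.dom, 0 < L.oA K t τ v ∧ 0 < L.oB K t τ v
  off : ∀ K t, |t| ≤ l₀ → ∀ τ ∈ T K \ Bad K t, ∀ v, v ∉ R.dom →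
    (∏ Y ∈ L.fac K t τ, Real.exp (EA (g K) (uA K v) Y - EA (g K) L.oneA Y)) * L.oA K t τ v = 0 ∧
    (∏ Y ∈ L.fac K t τ,
      Real.exp (EB (fun i => g (K + 1) (i + 1)) (uB K v) Y - EB (fun i => g (K + 1) (i + 1)) L.oneB Y)) *
      L.oB K t τ v = 0
  size : ∀ K t, |t| ≤ l₀ → ∀ τ ∈ T K \ Bad K t, ∀ v ∈ R.dom, ∀ j ≤ K,
    |(∑ Y ∈ L.fac K t τ with C.scale Y = j,
        (Real.log (Real.exp (EB (fun i => g (K + 1) (i + 1)) (uB K v) Y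
            - EB (fun i => g (K + 1) (i + 1)) L.oneB Y))
          - Real.log (Real.exp (EA (g K) (uA K v) Y - EA (g K) L.oneA Y)))) - L.κ₁ K t τ j| ≤ L.S K t τ j
  mult : ∀ K t, |t| ≤ l₀ → ∀ τ ∈ T K \ Bad K t,
    Multiplicity (L.fac K t τ) C.scale (fun Y => Real.exp (-(κ * C.d Y))) L.Cw vol L.Λg K
  other : ∀ K t, |t| ≤ l₀ → ∀ τ ∈ T K \ Bad K t, ∀ v ∈ R.dom,
    |Real.log (L.oB K t τ v) - Real.log (L.oA K t τ v) - L.cO K t τ| ≤ L.RO K t τ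
  vol_nonneg : 0 ≤ vol
  E₀_nonneg : 0 ≤ L.E₀
  a_pos : 0 < L.a
  a_lt_one : L.a < 1
  rate_gt : max ω θc < L.θ'
  θ₅_le : θ₅ ≤ L.θ'
  θ₃_le : θ₃ ≤ L.θ'
  rate_lt_one : L.θ' < 1
  rate_le_base : L.θ' ≤ L.Λg
  sizeProfile : ∀ K t, |t| ≤ l₀ → ∀ τ ∈ T K \ Bad K t, ∀ j ≤ K,
    L.S K t τ j ≤ vol * (L.E₀ * ((K : ℝ) + 1) ^ L.m * L.a ^ (K - j))
  RO_le : ∀ K t, |t| ≤ l₀ → ∀ τ ∈ T K \ Bad K t, L.RO K t τ ≤ vol * L.rO K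
  rO_summable : Summable L.rO
  dev : ∀ Cr : ℝ, 0 ≤ Cr → ∃ c₀ s : ℕ → ℝ, Summable s ∧
    ∀ K t, |t| ≤ l₀ → ∀ τ ∈ T K \ Bad K t,
      |((∑ j ∈ range (K + 1), sliceCentre (L.κ₁ K t τ)
          (fun j => ∑ Y ∈ L.fac K t τ with C.scale Y = j,
            (-(EB (fun i => g (K + 1) (i + 1)) L.oneB Y - EA (g K) L.oneA Y)))
          (L.S K t τ) (fun j => L.Cw * vol * (Cr * L.θ' ^ j * L.Λg ^ (K - j))) j) + L.cO K t τ) - c₀ K| ≤ vol * s K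

/-! ## §3 The N19 edge FROM the ledger predicate and the in-edges (node U2's OUTPUT letter) -/

section Edge

variable {C : Carriers} {ι X : Type} [MeasurableSpace ι] {σ : Type*} [DecidableEq σ] {L : LedgerData C ι σ}
  {l₀ vol : ℝ} {T : ℕ → Finset σ} {Bad : ℕ → ℝ → Finset σ} {A B : ℕ → ℝ → σ → ℝ}
  {R : Readings ι X} {W : Set (ℕ → ℝ)} {EA : Functional C C.BgA} {EB : Functional C C.BgB}
  {κ θ₅ C₅ C₉ ω θc Cd γ C₃ θ₃ P : ℝ} {q : ℕ} {Λm : ℕ → ℕ → ℝ} {CU : (ℕ → ℝ) → ℕ → ℝ}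
  {g : ℕ → ℕ → ℝ} {uA : ℕ → ι → C.BgA} {uB : ℕ → ι → C.BgB}

/-- **THE N19 EDGE FROM «Link S R»** (node U2's OUTPUT letter): the ledger predicate + the in-edges BY NAME — NE9 ∧ fading memory
(N22), the printed-grade argument bracket (T) `LipBackground` + `PolyLipGrowth`, NE5 (N18), NE3 in the minimal rate currency `LocalRate`
with the liaison `GaugeDominated` (N16's road), node U2's OUTPUT `InjectedRate Cd 0 θc disc` on the printed box (N17's road), both
runs' re-indexed couplings in the window — ⇒ `∃ δ, Spine.NE7.Core l₀ vol T Bad A B δ ∧ Summable δ` (node N19's decl of record with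
the `summable` leaf of `HybridNE7`).  ONE line over `core_summable_of_nodes_polySize` (p409886): the ledger supplies every non-edge
binder, H-U5b-1 at the tower constant the knit returns.  CONDITIONAL on every binder; NOT NE7. [folklore] -/
theorem core_summable_of_ledgerAt (hL : LedgerAt L l₀ vol T Bad A B R EA EB κ g uA uB ω θc θ₅ θ₃)
    (h9 : NE9 EA W κ Λm) (hΛm : FadingMemory C₉ ω Λm) (hω : 0 ≤ ω)
    (hUL : LipBackground EA W κ CU) (hG : PolyLipGrowth CU g P q) (hP : 0 ≤ P)
    (h5 : NE5 EA EB W κ θ₅ C₅) (hθ₅ : 0 ≤ θ₅) (hC₅ : 0 ≤ C₅)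
    (hloc : LocalRate R C₃ θ₃) (hC₃ : 0 ≤ C₃) (hθ₃ : 0 ≤ θ₃) (hθ₃1 : θ₃ < 1) (hgd : GaugeDominated R uA uB)
    (hinj : InjectedRate Cd 0 θc (fun K j => T4CouplingMatching.disc (g K) (g (K + 1)) j)) (hCd : 0 ≤ Cd)
    (hθc : 0 ≤ θc) (hbox : ∀ K i, i ≤ K → 0 < g K i ∧ g K i ≤ γ)
    (hgA : ∀ K, g K ∈ W) (hgB : ∀ K, (fun i => g (K + 1) (i + 1)) ∈ W) :
    ∃ δ : ℕ → ℝ, NE7.Core l₀ vol T Bad A B δ ∧ Summable δ := by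
  obtain ⟨Cr, hCr, H⟩ := core_summable_of_nodes_polySize (E₀ := L.E₀) (m := L.m)
    h9 hΛm hω hUL hG hP h5 hθ₅ hC₅ hloc hC₃ hθ₃ hθ₃1 hgd hinj hCd hθc hbox hgA hgB hL.rate_gt hL.θ₅_le hL.θ₃_le
    hL.fmtA hL.fmtB hL.int hL.sc hL.posO hL.off hL.size hL.mult hL.other hL.vol_nonneg hL.E₀_nonneg hL.a_pos
    hL.a_lt_one hL.rate_lt_one hL.rate_le_base hL.sizeProfile hL.RO_le hL.rO_summable
  obtain ⟨c₀, s, hs, hdev⟩ := hL.dev Cr hCr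
  exact ⟨_, H c₀ s hs hdev⟩

end Edge

end Summit.QuantumFields.YangMills.BalabanUVNodes.N19SizeWindow
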